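import Literature.MathematicalPhysics.QuantumLattice.HubbardScaleReport
import Literature.MathematicalPhysics.QuantumLattice.HubbardEffectiveActionCT
import HarnessLib

/-!
# The scale report of the seeded Hubbard torus in a counterterm frame (`hubbardScaleReportCT`)

Topic `Literature/MathematicalPhysics/QuantumLattice`; definition request `defn-hubbardScaleReportCT`
(D1″ of route HubbardSuperconductivity/AposterioriCapRg, route-repair of stmt-13960; it types the
CONCLUSION of `SeededBrokenRegimeBoseFermiPinned` = stmt-14042 and the HYPOTHESIS of
`AposterioriOrderCriterionR` = stmt-13884).

## Why a v2

`hubbardScaleReport` (`HubbardScaleReport.lean`, v1) decomposes scales around the BARE Fermi curve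
`{ξ = ε - μ = 0}` (its own "UPSTREAM" caveat): for `U > 0` the interacting Fermi curve of
`dWaveSourceTorus L U μ h` is displaced from `{ε = μ}` by the Hartree shift `≈ U n/2 ≫ Λ₀`, so the
below-scale shell, the patches and the nodes of v1 miss it.  `HubbardEffectiveActionCT.lean` (D1′a)
moved the frame: the effective action `hubbardEffectiveActionCT L M β U μ h K Λ₀` of the SAME model with
the Gaussian measure AND Salmhofer's cutoff on the renormalised band `e_K = ε_L - μ - K(p_k⃗)` of a
counterterm frame `K : TrigPolyC4v` (Feldman–Salmhofer–Trubowitz 1996, §1–2: `E = e + K`, the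
counterterm "treated as an extra interaction vertex"; BGM 2003 §1.2).  This file is v1 REBUILT ON THAT
ACTION, component by component, with the frame `∃`-bound INSIDE the realised set:

  `hubbardScaleReportCT U μ D h : HubbardScaleData.Report D.numPatches`,
  `p ∈ hubbardScaleReportCT U μ D h L β ⇔ ∀ δ > 0, ∃ᶠ M → ∞, ∃ K admissible, ∃ p' δ-close to p,`
  `  IsRealisedAtCT L M β U μ h K Λ₀ Np nodal p'`  (`L ≥ 1`; `∅` for `L = 0`; `∅` for `β ≤ 0`).

## The substitution table (v1 ↦ CT; everything else VERBATIM from v1)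

`nambuXi L μ` ↦ `nambuXiCT L μ K` and `hubbardEffectiveAction … Λ₀` ↦ `hubbardEffectiveActionCT … K Λ₀`
EVERYWHERE, i.e.:

* §1 geometry on `{e_K = 0}`: `InShell` ↦ `InShellCT` (`|e_K| < Λ₀`), `patchShell` ↦ `patchShellCT`,
  `fermiRay` ↦ `fermiRayCT` (first zero of the continuum renormalised band `ε(p) - μ - K(p)` on the
  ray), `nodePoint` ↦ `nodePointCT`, `bandGradient` ↦ `bandGradientCT K = ∇ε - ∇K` (`∇K =
  TrigPolyC4v.evalGrad`, PROVED to be the gradient: `TrigPolyC4v.hasDerivAt_eval_fst/snd`,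
  `hasDerivAt_renormalisedBand_fst/snd`), `freeFermiSpeed` ↦ `fermiSpeedCT`, `levelTangent` ↦
  `levelTangentCT`, `tangentialCoord` ↦ `tangentialCoordCT`; `InPatch`, `torusCentredMomentum`,
  `momentumAngle` unchanged (angular sectors do not read the band);
* §2 responses: the deformed family `twistedXi`, `deformedNambuDen`, …, `deformedCovAbove` (cutoff FROZEN
  at the reference `(μ, K, Λ₀)`: `hubbardCutoffWeightCT L M β μ K Λ₀`), `deformedEffAction` (interaction
  slot `V + 𝒩_K = hubbardInteractionCT`, frame frozen), `freeLogDet`, `mfFreeEnergy`, `scaleStiffness`,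
  `scaleCompressibility`, `scaleMeanFieldDensity` ↦ their `…CT` versions.  The twist `a` (uniform vector
  potential on the `x`-bonds) acts on the HOPPING term `ε` only (Peierls), exactly as in v1; the frame,
  like `μ` and `Λ₀` in the cutoff, is frozen reference data read at the untwisted momentum (the split
  `ξ = e_K + K` is a re-bracketing of the one-body term of the same deformed model for every `K`);
* §3 normal form: `modelEnergy` ↦ `modelEnergyCT` (`E = √((e_K + n)² + Δ²)`), `InFreqShell` ↦
  `InFreqShellCT`, `shellPairs`/`cooperCoefficient`/`cooperKept` ↦ `…CT`, `shellLegWeight`/`energyLegWeight`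
  ↦ `…CT` (weights `hubbardCutoffWeightCT`), `remainderOf` ↦ `remainderOfCT` (`𝒢^K - 𝒬(q) - 𝒦^K(𝒢^K)`),
  `scaledRemainderNorm` ↦ `scaledRemainderNormCT` (same leg-weighted `L¹–L^∞` norms `legKernelNorm`, same
  normalisation exponents `2m - 3`); `HubbardNormalForm` (normal shift `n`, anomalous `a`, field
  renormalisation `z`, all even; seven nodal pins), `gapFunction`, `normalFormQuadratic`, `pairLabel`,
  `pairFormFactor`, `cooperVertex`, `legKernelNorm` unchanged.  The residual static quadratic kernel left
  by an imperfect frame is charged to the normal shift `n` / the quadratic remainder exactly as in v1;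
* §4 the predicate: `GapCondition` (min-modulus) ↦ `GapConditionCT`, `SignCondition` ↦ `SignConditionCT`,
  `NodalCondition` ↦ `NodalConditionCT` (pins `z ≡ z_i`, `Δ = v_a t + d₃t³`,
  `e_K + n = s + (1+r)e_K + c₂t² + c₄t⁴` in `t = tangentialCoordCT`, `v_F = (1+r)|∇e_K(κ_i)|/(1+z)`,
  `v_Δ = |v_a|/(1+z)`), `IsRealisedAt` ↦ `IsRealisedAtCT L M β U μ h K Λ₀ Np nodal p`;
* §6 the report: Kuratowski upper limit in `M` as v1, with `∃ K, IsAdmissibleFrame K ∧ …` inside.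

## Admissible frames (the designer's documented choice, as the request allows)

`IsAdmissibleFrame K := K.coeffNorm 2 ≤ 16` (`reportFrameOrder = 2`, `reportFrameBound = 16`): the
`C²`-coefficient weight `Σ (1+m+n)² |κ_{m,n}|` of the frame is at most that of the bare band itself
(`ε = -4 h_{1,0}`, weight `(1+1)²·4 = 16`).  Consequences, all proved: `K = 0` is admissible
(`isAdmissibleFrame_zero`, needed for `hubbardScaleReport_subset_CT`); every frame with `coeffNorm r ≤ B`,
`r ≥ 2`, `B ≤ 16` is admissible (`IsAdmissibleFrame.of_coeffNorm_le`, by `TrigPolyC4v.coeffNorm_mono`) — in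
particular every frame admissible for a symmetric-regime certificate `π` with `κ_max ≤ 16`
(`SymmetricRegimeFunctionals`: decay order `6 ≥ 2`; the pinned `π₀` shared by stmt-14026/14042 is filed with
`coeffNorm ≤ 10`), so the producer crux loses nothing it had; and the consumer (criterion R) gets UNIFORM `C²`
control of `e_K`: `|K| ≤ 16`, `|∂ᵢK| ≤ 16` (`IsAdmissibleFrame.abs_eval_le`, `.abs_evalGrad_le`) and second
derivatives bounded by the same weight, i.e. a uniform Taylor remainder for the cone linearisation at the
nodes and a `C¹`-precompact family of frames along `M → ∞`.  Frames that push the shell `{|e_K| < Λ₀}` off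
the torus (e.g. a constant shift beyond the band edge) are NOT excluded by this bound and need not be: then
every field is above scale, the patch-shells are empty (reported gaps `0`, `GapConditionCT.eq_zero`;
`fermiRayCT ∈ {sInf ∅, sInf [0,∞)} = 0`, node at `Γ` where `∇e^c_K(0) = 0` by `evalGrad_neg`, so `v_F = 0`
on a patch declared nodal) and the responses are those of the fully integrated functional — an honest
description that no positive threshold certifies, as in v1 for `μ` outside the band.

## API (all proved; requirement (a)–(b) of the request)

Zero-frame lemmas `…_zero_frame` for every CT component (at `K = 0` each IS the v1 component), assembled
into **`isRealisedAtCT_zero_frame_iff`** (`IsRealisedAtCT … 0 Λ₀ … p ↔ IsRealisedAt … Λ₀ … p`); zero-twist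
lemmas `…_zero_twist` (at zero deformation the deformed CT objects are `hubbardCovarianceCT`,
`hubbardCovAboveCT`, `hubbardEffectiveActionCT`: the responses are derivatives of functionals of the CT
effective action itself); `scaledRemainderNormCT_nonneg`; `GapConditionCT.abs_le_abs/.eq_zero`,
`IsRealisedAtCT.exists_normalForm`, `IsRealisedAtCT.remainderNorm_nonneg`; **`isRealisedAtCT_free_noPatch`**
(non-vacuity at `U = 0`, `K = 0`); `hubbardScaleReportCT_eq`, `hubbardScaleReportCT_congr` (dependence on `D`
through `(scale, numPatches, nodal)` only), `hubbardScaleReportCTAt_zero_length`, `hubbardScaleReportCTAt_of_nonpos`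
(`β ≤ 0 ↦ ∅`), `mem_hubbardScaleReportCTAt_iff`, `mem_hubbardScaleReportCTAt_of_eventually`,
`remainderNorm_nonneg_of_mem_reportCT` (v1 owns the un-suffixed name), **`hubbardScaleReportCT_ne_univ`**,
`not_isCertifiedEnclosure_reportCT_of_remainderNorm_snd_neg`, `not_isCertifiedEnclosure_reportCT_of_empty`;
**`hubbardScaleReportAt_subset_CT`**, **`hubbardScaleReport_subset_CT`** and
`isCertifiedEnclosure_reportCT_of_report` (v1 certificates transfer, `IsCertifiedEnclosure.mono_report`).

## Caveats and what is NOT claimed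

* As v1: NON-EMPTINESS of the report for given parameters is NOT asserted (it needs `M`-uniform bounds,
  Pedra–Salmhofer 2008); `≠ Set.univ` IS proved.  No claim about the Hubbard model, about the size of any
  realised parameter, or that some frame holds the interacting Fermi curve fixed (no inversion theorem
  `E = e + K(e,λ)`; the frame is exhibited by whoever proves membership).  The frame may vary with `M`
  (and `δ`) inside the upper limit — the literal reading of "∃-bound inside the realised set"; a consumer
  wanting one frame along a subsequence uses the compactness afforded by `IsAdmissibleFrame`.
* `HubbardScaleData`, `MeetsThresholds`, `IsCertifiedEnclosure` are untouched; nothing here is specific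
  to the thresholds.  Conventions (`ρ_s` per site w.r.t. `a`, `κ = ∂n/∂μ`, `m₀ = Re⟨Δ_d⟩/L²`, velocities in
  lattice units, junk `log 0 = 0`, `x/0 = 0`, `sInf ∅ = 0`) are v1's.

## Sources

As `HubbardScaleReport.lean`: M. Salmhofer, Commun. Math. Phys. 194 (1998) 249, §2, §2.5, §4.1
[`Salmhofer1998`]; M. Salmhofer, *Renormalization* (1999), (2.105)–(2.106), (4.70)–(4.72), (4.85)
[`Salmhofer1999`]; G. Benfatto, A. Giuliani, V. Mastropietro, Ann. Henri Poincaré 7 (2006) 809, §2.5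
[`BenfattoGiulianiMastropietro2006`] and Ann. Henri Poincaré 4 (2003) 137, §1.1–1.2
[`BenfattoGiulianiMastropietro2003`]; J. Feldman, H. Knörrer, E. Trubowitz, CMP 247 (2004)
[`FeldmanKnorrerTrubowitz2004`]; T. Xiang, C. Wu, *D-wave Superconductivity* (CUP 2022), §7.3, §9.2
[`XiangWu2022`]; M. E. Fisher, M. N. Barber, D. Jasnow, PRA 8 (1973) 1111 [`FisherBarberJasnow1973`];
T. Koma, H. Tasaki, J. Stat. Phys. 76 (1994) 745, §1 [`KomaTasaki1994`]; W. Pedra, M. Salmhofer, CMP 282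
(2008) 797 [`PedraSalmhofer2008`]; plus, for the frame, J. Feldman, M. Salmhofer, E. Trubowitz, J. Stat.
Phys. 84 (1996) 1209, §1 ("the counterterms are chosen such that the interacting Fermi surface is held
fixed"; Discussion: `E = e + K`), §2 (flow of effective actions from `𝒢₀ = λV + 𝒦`)
[`FeldmanSalmhoferTrubowitz1996`].  The object itself is posited by the route (a-posteriori format,
Figueras–Haro–Luque 2016, Thm. 2.5; planner evidence REPAIR_13960.md §5), like v1.
-/

noncomputable section

namespace Literature.MathematicalPhysics.QuantumLattice

open Literature.Probability.LatticeModels GrassmannAlgebra Finset Filter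

/-! ### §0 Frame calculus: the gradient of a frame, coefficient-weight monotonicity, admissibility -/

namespace TrigPolyC4v

/-- The gradient of the symmetrised harmonic `h_{m,n}(p) = ½(cos(m p₁)cos(n p₂) + cos(n p₁)cos(m p₂))`:
`∂₁h = -½(m sin(m p₁)cos(n p₂) + n sin(n p₁)cos(m p₂))`, `∂₂h = -½(n cos(m p₁)sin(n p₂) + m cos(n p₁)sin(m p₂))`
(proved to be the partial derivatives: `hasDerivAt_harmonic_fst/snd`). [folklore] -/
def harmonicGrad (m n : ℕ) (p : Fin 2 → ℝ) : Fin 2 → ℝ :=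
  ![-((m * Real.sin (m * p 0) * Real.cos (n * p 1) + n * Real.sin (n * p 0) * Real.cos (m * p 1)) / 2),
    -((n * Real.cos (m * p 0) * Real.sin (n * p 1) + m * Real.cos (n * p 0) * Real.sin (m * p 1)) / 2)]

/-- **The gradient `∇K(p)` of a frame**, `Σ_{m,n ≤ d} κ_{m,n} ∇h_{m,n}(p)` (termwise; proved to be the
gradient of `TrigPolyC4v.eval`: `hasDerivAt_eval_fst/snd`). [folklore] -/
def evalGrad (K : TrigPolyC4v) (p : Fin 2 → ℝ) : Fin 2 → ℝ :=
  fun i => ∑ m ∈ range (K.degree + 1), ∑ n ∈ range (K.degree + 1), K.coeff m n * harmonicGrad m n p i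

/-- The bare frame has zero gradient. [folklore] -/
@[simp] theorem evalGrad_zero (p : Fin 2 → ℝ) : (0 : TrigPolyC4v).evalGrad p = 0 := by
  funext i; simp [evalGrad]

/-- `d/dx cos(m x) = -m sin(m x)`. [folklore] -/
theorem hasDerivAt_cos_nat_mul (m : ℕ) (x : ℝ) :
    HasDerivAt (fun x : ℝ => Real.cos (m * x)) (-(m * Real.sin (m * x))) x := by
  have h : HasDerivAt (fun x : ℝ => (m : ℝ) * x) (m : ℝ) x := by
    simpa using (hasDerivAt_id x).const_mul (m : ℝ)
  convert h.cos using 1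
  ring

/-- `harmonicGrad m n p 0` is `∂h_{m,n}/∂p₁`. [folklore] -/
theorem hasDerivAt_harmonic_fst (m n : ℕ) (x y : ℝ) :
    HasDerivAt (fun x => harmonic m n ![x, y]) (harmonicGrad m n ![x, y] 0) x := by
  have hf : (fun x => harmonic m n ![x, y]) =
      fun x => (Real.cos (m * x) * Real.cos (n * y) + Real.cos (n * x) * Real.cos (m * y)) / 2 := by
    funext x; simp [harmonic]
  have hd : harmonicGrad m n ![x, y] 0 =
      (-(m * Real.sin (m * x)) * Real.cos (n * y) + -(n * Real.sin (n * x)) * Real.cos (m * y)) / 2 := by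
    simp [harmonicGrad]; ring
  rw [hf, hd]
  exact (((hasDerivAt_cos_nat_mul m x).mul_const _).add ((hasDerivAt_cos_nat_mul n x).mul_const _)).div_const 2

/-- `harmonicGrad m n p 1` is `∂h_{m,n}/∂p₂`. [folklore] -/
theorem hasDerivAt_harmonic_snd (m n : ℕ) (x y : ℝ) :
    HasDerivAt (fun y => harmonic m n ![x, y]) (harmonicGrad m n ![x, y] 1) y := by
  have hf : (fun y => harmonic m n ![x, y]) =
      fun y => (Real.cos (m * x) * Real.cos (n * y) + Real.cos (n * x) * Real.cos (m * y)) / 2 := by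
    funext y; simp [harmonic]
  have hd : harmonicGrad m n ![x, y] 1 =
      (Real.cos (m * x) * -(n * Real.sin (n * y)) + Real.cos (n * x) * -(m * Real.sin (m * y))) / 2 := by
    simp [harmonicGrad]; ring
  rw [hf, hd]
  exact (((hasDerivAt_cos_nat_mul n y).const_mul _).add ((hasDerivAt_cos_nat_mul m y).const_mul _)).div_const 2

/-- **`evalGrad` is the gradient of the frame**, first component: `∂K/∂p₁ = evalGrad K p 0`. [folklore] -/
theorem hasDerivAt_eval_fst (K : TrigPolyC4v) (x y : ℝ) :
    HasDerivAt (fun x => K.eval ![x, y]) (K.evalGrad ![x, y] 0) x := by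
  simp only [eval, evalGrad]
  refine HasDerivAt.fun_sum fun m _ => HasDerivAt.fun_sum fun n _ => ?_
  exact (hasDerivAt_harmonic_fst m n x y).const_mul _

/-- **`evalGrad` is the gradient of the frame**, second component: `∂K/∂p₂ = evalGrad K p 1`. [folklore] -/
theorem hasDerivAt_eval_snd (K : TrigPolyC4v) (x y : ℝ) :
    HasDerivAt (fun y => K.eval ![x, y]) (K.evalGrad ![x, y] 1) y := by
  simp only [eval, evalGrad]
  refine HasDerivAt.fun_sum fun m _ => HasDerivAt.fun_sum fun n _ => ?_
  exact (hasDerivAt_harmonic_snd m n x y).const_mul _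

/-- The harmonic gradients are odd, `∇h(-p) = -∇h(p)`. [folklore] -/
theorem harmonicGrad_neg (m n : ℕ) (p : Fin 2 → ℝ) : harmonicGrad m n (-p) = -harmonicGrad m n p := by
  funext i
  fin_cases i <;> simp [harmonicGrad, mul_neg, Real.sin_neg, Real.cos_neg] <;> ring

/-- **The gradient of a frame is odd**, `∇K(-p) = -∇K(p)` (frames are even): in particular `∇K(0) = 0`.
[folklore] -/
theorem evalGrad_neg (K : TrigPolyC4v) (p : Fin 2 → ℝ) : K.evalGrad (-p) = -K.evalGrad p := by
  funext i
  simp [evalGrad, harmonicGrad_neg, Finset.sum_neg_distrib, mul_neg]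

/-- `|∂ᵢ h_{m,n}| ≤ 1 + m + n` (crudely: `|∂ᵢh_{m,n}| ≤ (m + n)/2`). [folklore] -/
theorem abs_harmonicGrad_le (m n : ℕ) (p : Fin 2 → ℝ) (i : Fin 2) : |harmonicGrad m n p i| ≤ 1 + m + n := by
  have key : ∀ (a b : ℕ) (s c s' c' : ℝ), |s| ≤ 1 → |c| ≤ 1 → |s'| ≤ 1 → |c'| ≤ 1 →
      |-((a * s * c + b * s' * c') / 2)| ≤ 1 + a + b := by
    intro a b s c s' c' h1 h2 h3 h4
    rw [abs_neg, abs_div, abs_two]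
    have ha : |(a : ℝ) * s * c| ≤ a := by
      rw [abs_mul, abs_mul, Nat.abs_cast]
      calc (a : ℝ) * |s| * |c| ≤ a * 1 * 1 := by gcongr
        _ = a := by ring
    have hb : |(b : ℝ) * s' * c'| ≤ b := by
      rw [abs_mul, abs_mul, Nat.abs_cast]
      calc (b : ℝ) * |s'| * |c'| ≤ b * 1 * 1 := by gcongr
        _ = b := by ring
    have := abs_add_le ((a : ℝ) * s * c) (b * s' * c')
    rw [div_le_iff₀ (by norm_num : (0 : ℝ) < 2)]
    have ha0 : (0 : ℝ) ≤ a := Nat.cast_nonneg _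
    have hb0 : (0 : ℝ) ≤ b := Nat.cast_nonneg _
    linarith
  fin_cases i
  · simpa [harmonicGrad] using key m n (Real.sin (m * p 0)) (Real.cos (n * p 1)) (Real.sin (n * p 0))
      (Real.cos (m * p 1)) (Real.abs_sin_le_one _) (Real.abs_cos_le_one _) (Real.abs_sin_le_one _)
      (Real.abs_cos_le_one _)
  · have := key n m (Real.sin (n * p 1)) (Real.cos (m * p 0)) (Real.sin (m * p 1)) (Real.cos (n * p 0))
      (Real.abs_sin_le_one _) (Real.abs_cos_le_one _) (Real.abs_sin_le_one _) (Real.abs_cos_le_one _)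
    have e : harmonicGrad m n p 1 = -((n * Real.sin (n * p 1) * Real.cos (m * p 0) +
        m * Real.sin (m * p 1) * Real.cos (n * p 0)) / 2) := by
      simp [harmonicGrad]; ring
    show |harmonicGrad m n p 1| ≤ _
    rw [e]
    calc _ ≤ 1 + (n : ℝ) + m := this
      _ = 1 + m + n := by ring

/-- **`sup_p |∂ᵢK(p)| ≤ coeffNorm 1 K`**: the order-`1` coefficient weight bounds the gradient of the frame
(as `abs_eval_le_coeffNorm` bounds its values by the order-`0` weight). [folklore] -/
theorem abs_evalGrad_le_coeffNorm (K : TrigPolyC4v) (p : Fin 2 → ℝ) (i : Fin 2) :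
    |K.evalGrad p i| ≤ K.coeffNorm 1 := by
  rw [evalGrad, coeffNorm]
  refine (abs_sum_le_sum_abs _ _).trans (sum_le_sum fun m _ => (abs_sum_le_sum_abs _ _).trans
    (sum_le_sum fun n _ => ?_))
  rw [abs_mul, pow_one, mul_comm]
  exact mul_le_mul_of_nonneg_right (abs_harmonicGrad_le m n p i) (abs_nonneg _)

/-- **The coefficient weights increase with the order**: `coeffNorm r K ≤ coeffNorm r' K` for `r ≤ r'`
(`1 + m + n ≥ 1`). [folklore] -/
theorem coeffNorm_mono {r r' : ℕ} (h : r ≤ r') (K : TrigPolyC4v) : K.coeffNorm r ≤ K.coeffNorm r' := by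
  refine sum_le_sum fun m _ => sum_le_sum fun n _ => mul_le_mul_of_nonneg_right ?_ (abs_nonneg _)
  exact pow_le_pow_right₀ (by norm_cast; omega) h

end TrigPolyC4v

/-- The order of the coefficient weight in which the report bounds its frames: `2` (uniform `C²` control of
`e_K`, what the cone linearisation at a node consumes). Design choice of this file (module docstring,
"Admissible frames"). [folklore] -/
def reportFrameOrder : ℕ := 2

/-- The bound on the order-`2` coefficient weight of an admissible frame: `16`, the order-`2` weight of the
bare band `ε = -4h_{1,0}` itself. Design choice of this file (module docstring, "Admissible frames").
[folklore] -/
def reportFrameBound : ℝ := 16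

/-- **`IsAdmissibleFrame K`**: the frames over which the report's `∃ K` ranges —
`Σ_{m,n} (1+m+n)² |κ_{m,n}| ≤ 16` (the request lets the designer restrict the frames to exclude junk and asks
for the choice to be documented: module docstring, "Admissible frames"). [folklore] -/
def IsAdmissibleFrame (K : TrigPolyC4v) : Prop :=
  K.coeffNorm reportFrameOrder ≤ reportFrameBound

/-- Unfolding `IsAdmissibleFrame`. [folklore] -/
theorem isAdmissibleFrame_iff (K : TrigPolyC4v) : IsAdmissibleFrame K ↔ K.coeffNorm 2 ≤ 16 := Iff.rfl

/-- **The bare frame `K = 0` is admissible** (so v1's report sits inside the CT report,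
`hubbardScaleReport_subset_CT`). [folklore] -/
theorem isAdmissibleFrame_zero : IsAdmissibleFrame 0 := by
  rw [isAdmissibleFrame_iff, TrigPolyC4v.coeffNorm]
  norm_num

/-- A frame bounded in a coefficient weight of order `r ≥ 2` by `B ≤ 16` is admissible — e.g. every frame
admissible for a symmetric-regime certificate with `κ_max ≤ 16` at decay order `6`. [folklore] -/
theorem IsAdmissibleFrame.of_coeffNorm_le {K : TrigPolyC4v} {r : ℕ} (hr : reportFrameOrder ≤ r) {B : ℝ}
    (hB : B ≤ reportFrameBound) (h : K.coeffNorm r ≤ B) : IsAdmissibleFrame K :=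
  ((TrigPolyC4v.coeffNorm_mono hr K).trans h).trans hB

/-- An admissible frame is uniformly bounded: `|K(p)| ≤ 16`. [folklore] -/
theorem IsAdmissibleFrame.abs_eval_le {K : TrigPolyC4v} (hK : IsAdmissibleFrame K) (p : Fin 2 → ℝ) :
    |K.eval p| ≤ reportFrameBound :=
  ((K.abs_eval_le_coeffNorm p).trans (TrigPolyC4v.coeffNorm_mono (Nat.zero_le _) K)).trans hK

/-- An admissible frame has a uniformly bounded gradient: `|∂ᵢK(p)| ≤ 16`. [folklore] -/
theorem IsAdmissibleFrame.abs_evalGrad_le {K : TrigPolyC4v} (hK : IsAdmissibleFrame K) (p : Fin 2 → ℝ)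
    (i : Fin 2) : |K.evalGrad p i| ≤ reportFrameBound :=
  ((K.abs_evalGrad_le_coeffNorm p i).trans (TrigPolyC4v.coeffNorm_mono (by decide) K)).trans hK

/-! ### §1 Patch geometry on the renormalised Fermi curve `{e_K = 0}` -/

section GeometryCT

variable (L : ℕ)

/-- `InShellCT L μ K Λ₀ k`: the torus momentum `k⃗` lies in the spatial shell `|e_K(k⃗)| < Λ₀` around the
RENORMALISED Fermi curve `{e_K = 0}`, `e_K = nambuXiCT L μ K` (v1 `InShell` with `ξ ↦ e_K`; the spatial
shell named in `HubbardEffectiveActionCT.lean`, design notes). [folklore] -/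
def InShellCT (μ : ℝ) (K : TrigPolyC4v) (Λ₀ : ℝ) (k : TorusSite 2 L) : Prop :=
  |nambuXiCT L μ K k| < Λ₀

/-- Bare frame: `InShellCT … 0 … ↔ InShell`. [folklore] -/
theorem inShellCT_zero_frame (μ Λ₀ : ℝ) (k : TorusSite 2 L) : InShellCT L μ 0 Λ₀ k ↔ InShell L μ Λ₀ k := by
  rw [InShellCT, nambuXiCT_zero_frame, InShell]

open Classical in
/-- The **CT patch-shell** `S^K_i`: the torus momenta of patch `i` (angular sector `InPatch`, unchanged)
inside the shell `|e_K| < Λ₀` (v1 `patchShell` with `ξ ↦ e_K`). [folklore] -/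
def patchShellCT [NeZero L] (μ : ℝ) (K : TrigPolyC4v) (Λ₀ : ℝ) (Np : ℕ) (i : Fin Np) : Finset (TorusSite 2 L) :=
  Finset.univ.filter fun k => InPatch L Np i k ∧ InShellCT L μ K Λ₀ k

/-- Membership in a CT patch-shell. [folklore] -/
theorem mem_patchShellCT_iff [NeZero L] (μ : ℝ) (K : TrigPolyC4v) (Λ₀ : ℝ) (Np : ℕ) (i : Fin Np)
    (k : TorusSite 2 L) : k ∈ patchShellCT L μ K Λ₀ Np i ↔ InPatch L Np i k ∧ |nambuXiCT L μ K k| < Λ₀ := by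
  simp [patchShellCT, InShellCT]

/-- Bare frame: the CT patch-shell is v1's `patchShell`. [folklore] -/
@[simp] theorem patchShellCT_zero_frame [NeZero L] (μ Λ₀ : ℝ) (Np : ℕ) (i : Fin Np) :
    patchShellCT L μ 0 Λ₀ Np i = patchShell L μ Λ₀ Np i := by
  ext k
  simp [patchShellCT, patchShell, inShellCT_zero_frame]

/-- The first zero of the continuum renormalised band `e^c_K(p) = ε(p) - μ - K(p)` along the ray of angle
`θ`: `inf {t ≥ 0 : μ + K(t·dir θ) ≤ ε(t·dir θ)}` (the renormalised Fermi radius in direction `θ` when the ray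
meets `{e^c_K = 0}`; junk `0 = sInf ∅` otherwise; v1 `fermiRay` with `ε - μ ↦ ε - μ - K`). [folklore] -/
def fermiRayCT (μ : ℝ) (K : TrigPolyC4v) (θ : ℝ) : ℝ :=
  sInf {t : ℝ | 0 ≤ t ∧ μ + K.eval (t • dir θ) ≤ sqDispersion (t • dir θ)}

/-- Bare frame: `fermiRayCT μ 0 = fermiRay μ`. [folklore] -/
@[simp] theorem fermiRayCT_zero_frame (μ θ : ℝ) : fermiRayCT μ 0 θ = fermiRay μ θ := by
  simp [fermiRayCT, fermiRay]

/-- The **CT reference node** of patch `i`: the point of `{e^c_K = 0}` on the central ray of the patch,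
`κ^K_i = fermiRayCT μ K θ_i · dir θ_i`, `θ_i = 2πi/Np`. [folklore] -/
def nodePointCT (μ : ℝ) (K : TrigPolyC4v) (Np : ℕ) (i : Fin Np) : Fin 2 → ℝ :=
  fermiRayCT μ K (2 * Real.pi * (i : ℕ) / Np) • dir (2 * Real.pi * (i : ℕ) / Np)

/-- Bare frame: `nodePointCT μ 0 = nodePoint μ`. [folklore] -/
@[simp] theorem nodePointCT_zero_frame (μ : ℝ) (Np : ℕ) (i : Fin Np) : nodePointCT μ 0 Np i = nodePoint μ Np i := by
  rw [nodePointCT, fermiRayCT_zero_frame, nodePoint]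

/-- The gradient `∇e^c_K = ∇ε - ∇K` of the continuum renormalised band (`∇ε = bandGradient`,
`∇K = TrigPolyC4v.evalGrad`; proved: `hasDerivAt_renormalisedBand_fst/snd`). [folklore] -/
def bandGradientCT (K : TrigPolyC4v) (k : Fin 2 → ℝ) : Fin 2 → ℝ :=
  bandGradient k - K.evalGrad k

/-- Bare frame: `bandGradientCT 0 = bandGradient`. [folklore] -/
@[simp] theorem bandGradientCT_zero_frame (k : Fin 2 → ℝ) : bandGradientCT 0 k = bandGradient k := by
  rw [bandGradientCT, TrigPolyC4v.evalGrad_zero, sub_zero]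

/-- **`bandGradientCT` is the gradient of the continuum renormalised band** `p ↦ ε(p) - μ - K(p)`
(`ε = sqDispersion`), first component. [folklore] -/
theorem hasDerivAt_renormalisedBand_fst (μ : ℝ) (K : TrigPolyC4v) (x y : ℝ) :
    HasDerivAt (fun x => sqDispersion ![x, y] - μ - K.eval ![x, y]) (bandGradientCT K ![x, y] 0) x := by
  have hε : HasDerivAt (fun x => sqDispersion ![x, y]) (bandGradient ![x, y] 0) x := by
    have h1 : HasDerivAt (fun x : ℝ => -2 * (Real.cos x + Real.cos y)) (-2 * (-Real.sin x + 0)) x :=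
      ((Real.hasDerivAt_cos x).add (hasDerivAt_const x _)).const_mul _
    convert h1 using 1
    · funext x; simp [sqDispersion]
    · simp [bandGradient]
  have h := (hε.sub_const μ).fun_sub (K.hasDerivAt_eval_fst x y)
  simpa only [bandGradientCT, Pi.sub_apply] using h

/-- **`bandGradientCT` is the gradient of the continuum renormalised band**, second component. [folklore] -/
theorem hasDerivAt_renormalisedBand_snd (μ : ℝ) (K : TrigPolyC4v) (x y : ℝ) :
    HasDerivAt (fun y => sqDispersion ![x, y] - μ - K.eval ![x, y]) (bandGradientCT K ![x, y] 1) y := by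
  have hε : HasDerivAt (fun y => sqDispersion ![x, y]) (bandGradient ![x, y] 1) y := by
    have h1 : HasDerivAt (fun y : ℝ => -2 * (Real.cos x + Real.cos y)) (-2 * (0 + -Real.sin y)) y :=
      ((hasDerivAt_const y _).add (Real.hasDerivAt_cos y)).const_mul _
    convert h1 using 1
    · funext y; simp [sqDispersion]
    · simp [bandGradient]
  have h := (hε.sub_const μ).fun_sub (K.hasDerivAt_eval_snd x y)
  simpa only [bandGradientCT, Pi.sub_apply] using h

/-- The renormalised Fermi speed `|∇e^c_K(k)|`. [folklore] -/
def fermiSpeedCT (K : TrigPolyC4v) (k : Fin 2 → ℝ) : ℝ :=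
  Real.sqrt (bandGradientCT K k 0 ^ 2 + bandGradientCT K k 1 ^ 2)

/-- Bare frame: `fermiSpeedCT 0 = freeFermiSpeed`. [folklore] -/
@[simp] theorem fermiSpeedCT_zero_frame (k : Fin 2 → ℝ) : fermiSpeedCT 0 k = freeFermiSpeed k := by
  rw [fermiSpeedCT, bandGradientCT_zero_frame, freeFermiSpeed]

/-- The unit tangent to the level curve of `e^c_K` at `k` (gradient rotated by `+π/2`; junk `0` where the
gradient vanishes). [folklore] -/
def levelTangentCT (K : TrigPolyC4v) (k : Fin 2 → ℝ) : Fin 2 → ℝ :=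
  ![-(bandGradientCT K k 1) / fermiSpeedCT K k, bandGradientCT K k 0 / fermiSpeedCT K k]

/-- Bare frame: `levelTangentCT 0 = levelTangent`. [folklore] -/
@[simp] theorem levelTangentCT_zero_frame (k : Fin 2 → ℝ) : levelTangentCT 0 k = levelTangent k := by
  rw [levelTangentCT, bandGradientCT_zero_frame, fermiSpeedCT_zero_frame, levelTangent]

/-- The **CT tangential coordinate** of a torus momentum relative to the CT reference node of patch `i`:
`t_i(k⃗) = (k⃗ - κ^K_i) · τ̂_K(κ^K_i)` (v1 `tangentialCoord` on `{e^c_K = 0}`; BGM 2006 (2.46)–(2.47) at the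
node). [cite: BenfattoGiulianiMastropietro2006, §2.5 (2.46)–(2.47)] -/
def tangentialCoordCT (μ : ℝ) (K : TrigPolyC4v) (Np : ℕ) (i : Fin Np) (k : TorusSite 2 L) : ℝ :=
  (torusCentredMomentum L k 0 - nodePointCT μ K Np i 0) * levelTangentCT K (nodePointCT μ K Np i) 0 +
    (torusCentredMomentum L k 1 - nodePointCT μ K Np i 1) * levelTangentCT K (nodePointCT μ K Np i) 1

/-- Bare frame: `tangentialCoordCT L μ 0 = tangentialCoord L μ`. [folklore] -/
@[simp] theorem tangentialCoordCT_zero_frame (μ : ℝ) (Np : ℕ) (i : Fin Np) (k : TorusSite 2 L) :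
    tangentialCoordCT L μ 0 Np i k = tangentialCoord L μ Np i k := by
  rw [tangentialCoordCT, nodePointCT_zero_frame, levelTangentCT_zero_frame, tangentialCoord]

end GeometryCT

/-! ### §2 The deformed CT covariance and the scale-`Λ₀` mean-field free energy in the frame `K` -/

section DeformedCT

variable (L M : ℕ)

/-- The twisted renormalised band: `e^{(s)}_{K,μ',a}(k⃗) = -2(cos(p₁ + s a) + cos p₂) - μ' - K(p_k⃗)` — the
Peierls twist acts on the hopping term only, the frame is read at the untwisted momentum (frozen
reference data; v1 `twistedXi` with `- K(p_k⃗)`). [folklore] -/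
def twistedXiCT (μ' : ℝ) (K : TrigPolyC4v) (a s : ℝ) (k : TorusSite 2 L) : ℝ :=
  twistedXi L μ' a s k - K.eval (latticeMomentum L k)

/-- Bare frame: `twistedXiCT … 0 … = twistedXi`. [folklore] -/
@[simp] theorem twistedXiCT_zero_frame (μ' a s : ℝ) (k : TorusSite 2 L) :
    twistedXiCT L μ' 0 a s k = twistedXi L μ' a s k := by
  rw [twistedXiCT, TrigPolyC4v.eval_zero, sub_zero]

/-- Without twist the twisted renormalised band is `e_K`. [folklore] -/
@[simp] theorem twistedXiCT_zero_twist (μ' : ℝ) (K : TrigPolyC4v) (s : ℝ) (k : TorusSite 2 L) :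
    twistedXiCT L μ' K 0 s k = nambuXiCT L μ' K k := by
  rw [twistedXiCT, twistedXi_zero, nambuXiCT, nambuXi]

/-- Minus the determinant of the deformed inverse Nambu propagator in the frame `K` (v1 `deformedNambuDen`
with `ξ± ↦ e±`). [folklore] -/
def deformedNambuDenCT (β μ' h' : ℝ) (K : TrigPolyC4v) (a : ℝ) (k : FreqMomentum L M) : ℂ :=
  (matsubaraFreq β M k.1 : ℂ) ^ 2 + (twistedXiCT L μ' K a 1 k.2 : ℂ) * (twistedXiCT L μ' K a (-1) k.2 : ℂ) +
      ((h' * dWaveSymbol L k.2 : ℝ) : ℂ) ^ 2 -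
    Complex.I * (matsubaraFreq β M k.1 : ℂ) *
      ((twistedXiCT L μ' K a (-1) k.2 : ℂ) - (twistedXiCT L μ' K a 1 k.2 : ℂ))

/-- The **deformed Nambu propagator in the frame `K`**, `(-iω + M^K_{a,μ',h'}(k⃗))⁻¹` entrywise (v1
`deformedNambuPropagator` with `ξ± ↦ e±`). [folklore] -/
def deformedNambuPropagatorCT (β μ' h' : ℝ) (K : TrigPolyC4v) (a : ℝ) (k : FreqMomentum L M) :
    Matrix (Fin 2) (Fin 2) ℂ :=
  !![(Complex.I * matsubaraFreq β M k.1 + twistedXiCT L μ' K a (-1) k.2) / deformedNambuDenCT L M β μ' h' K a k,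
      (h' * dWaveSymbol L k.2 : ℝ) / deformedNambuDenCT L M β μ' h' K a k;
    (h' * dWaveSymbol L k.2 : ℝ) / deformedNambuDenCT L M β μ' h' K a k,
      (Complex.I * matsubaraFreq β M k.1 - twistedXiCT L μ' K a 1 k.2) / deformedNambuDenCT L M β μ' h' K a k]

/-- Bare frame: `deformedNambuDenCT … 0 a = deformedNambuDen … a`. [folklore] -/
theorem deformedNambuDenCT_zero_frame (β μ' h' a : ℝ) (k : FreqMomentum L M) :
    deformedNambuDenCT L M β μ' h' 0 a k = deformedNambuDen L M β μ' h' a k := by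
  simp only [deformedNambuDenCT, deformedNambuDen, twistedXiCT_zero_frame]

/-- Without twist the deformed CT denominator is `nambuDenCT`. [folklore] -/
theorem deformedNambuDenCT_zero_twist (β μ' h' : ℝ) (K : TrigPolyC4v) (k : FreqMomentum L M) :
    deformedNambuDenCT L M β μ' h' K 0 k = (nambuDenCT L M β μ' h' K k : ℂ) := by
  simp only [deformedNambuDenCT, twistedXiCT_zero_twist, nambuDenCT, sub_self, mul_zero, sub_zero]
  push_cast
  ring

/-- Bare frame: `deformedNambuPropagatorCT … 0 a = deformedNambuPropagator … a`. [folklore] -/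
theorem deformedNambuPropagatorCT_zero_frame (β μ' h' a : ℝ) (k : FreqMomentum L M) :
    deformedNambuPropagatorCT L M β μ' h' 0 a k = deformedNambuPropagator L M β μ' h' a k := by
  simp only [deformedNambuPropagatorCT, deformedNambuPropagator, twistedXiCT_zero_frame,
    deformedNambuDenCT_zero_frame]

/-- **Without twist the deformed CT propagator is `nambuPropagatorCT`**: the response functionals below are
deformations of the CT covariance itself. [folklore] -/
theorem deformedNambuPropagatorCT_zero_twist (β μ' h' : ℝ) (K : TrigPolyC4v) (k : FreqMomentum L M) :
    deformedNambuPropagatorCT L M β μ' h' K 0 k = nambuPropagatorCT L M β μ' h' K k := by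
  ext i j
  fin_cases i <;> fin_cases j <;>
    simp [deformedNambuPropagatorCT, nambuPropagatorCT, deformedNambuDenCT_zero_twist, twistedXiCT_zero_twist]

/-- The deformed CT two-point table in Nambu labels (as `deformedNambuTwoPoint`; the frame, like the
propagator, read at the Nambu momentum of the first argument). [folklore] -/
def deformedNambuTwoPointCT (β μ' h' : ℝ) (K : TrigPolyC4v) (a : ℝ) (X Y : (FreqMomentum L M × Fin 2) × Fin 2) : ℂ :=
  if X.2 = 1 ∧ Y.2 = 0 ∧ X.1.1 = Y.1.1 then
    ((β * (L : ℝ) ^ 2 : ℝ) : ℂ) * deformedNambuPropagatorCT L M β μ' h' K a X.1.1 X.1.2 Y.1.2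
  else 0

/-- The deformed CT two-point table of the original fields (transport along `toNambu`, antisymmetrised).
[folklore] -/
def deformedTwoPointCT (β μ' h' : ℝ) (K : TrigPolyC4v) (a : ℝ) (X Y : HubbardFieldIdx L M) : ℂ :=
  deformedNambuTwoPointCT L M β μ' h' K a (toNambu X) (toNambu Y) -
    deformedNambuTwoPointCT L M β μ' h' K a (toNambu Y) (toNambu X)

/-- The **deformed CT covariance** `C^K_{a,μ',h'}` (convention `C(X,Y) = -⟨ψ_X ψ_Y⟩₀`). [folklore] -/
def deformedCovarianceCT (β μ' h' : ℝ) (K : TrigPolyC4v) (a : ℝ) :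
    Matrix (HubbardFieldIdx L M) (HubbardFieldIdx L M) ℂ :=
  Matrix.of fun X Y => -deformedTwoPointCT L M β μ' h' K a X Y

/-- Bare frame: `deformedCovarianceCT … 0 a = deformedCovariance … a`. [folklore] -/
theorem deformedCovarianceCT_zero_frame (β μ' h' a : ℝ) :
    deformedCovarianceCT L M β μ' h' 0 a = deformedCovariance L M β μ' h' a := by
  ext X Y
  simp only [deformedCovarianceCT, deformedCovariance, Matrix.of_apply, deformedTwoPointCT, deformedTwoPoint,
    deformedNambuTwoPointCT, deformedNambuTwoPoint, deformedNambuPropagatorCT_zero_frame]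

/-- **At zero deformation the deformed CT covariance is `hubbardCovarianceCT`.** [folklore] -/
theorem deformedCovarianceCT_zero_twist (β μ h : ℝ) (K : TrigPolyC4v) :
    deformedCovarianceCT L M β μ h K 0 = hubbardCovarianceCT L M β μ h K := by
  ext X Y
  simp only [deformedCovarianceCT, hubbardCovarianceCT, Matrix.of_apply, deformedTwoPointCT, hubbardTwoPointCT,
    deformedNambuTwoPointCT, nambuTwoPointCT, deformedNambuPropagatorCT_zero_twist]

/-- The **deformed CT covariance above scale `Λ₀`** with the cutoff weights FROZEN at the reference data
`(μ, K, Λ₀)`: `C^{K,>}_{a,μ',h'}(X,Y) = ½(w^K(k_X) + w^K(k_Y)) C^K_{a,μ',h'}(X,Y)`,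
`w^K = hubbardCutoffWeightCT L M β μ K Λ₀` (v1 `deformedCovAbove`: only the covariance is deformed, not the
scale decomposition). [folklore] -/
def deformedCovAboveCT (β μ : ℝ) (K : TrigPolyC4v) (Λ₀ μ' h' a : ℝ) :
    Matrix (HubbardFieldIdx L M) (HubbardFieldIdx L M) ℂ :=
  Matrix.of fun X Y =>
    (((hubbardCutoffWeightCT L M β μ K Λ₀ (momentumOf L M X) +
        hubbardCutoffWeightCT L M β μ K Λ₀ (momentumOf L M Y)) / 2 : ℝ) : ℂ) *
      deformedCovarianceCT L M β μ' h' K a X Y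

/-- The deformed CT covariance at and below scale, `C^{K,≤} = C^K - C^{K,>}`. [folklore] -/
def deformedCovBelowCT (β μ : ℝ) (K : TrigPolyC4v) (Λ₀ μ' h' a : ℝ) :
    Matrix (HubbardFieldIdx L M) (HubbardFieldIdx L M) ℂ :=
  deformedCovarianceCT L M β μ' h' K a - deformedCovAboveCT L M β μ K Λ₀ μ' h' a

/-- Bare frame: `deformedCovAboveCT … 0 Λ₀ … = deformedCovAbove … Λ₀ …`. [folklore] -/
theorem deformedCovAboveCT_zero_frame (β μ Λ₀ μ' h' a : ℝ) :
    deformedCovAboveCT L M β μ 0 Λ₀ μ' h' a = deformedCovAbove L M β μ Λ₀ μ' h' a := by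
  ext X Y
  simp only [deformedCovAboveCT, deformedCovAbove, Matrix.of_apply, hubbardCutoffWeightCT_zero_frame,
    deformedCovarianceCT_zero_frame]

/-- At zero deformation `C^{K,>}` is `hubbardCovAboveCT`. [folklore] -/
theorem deformedCovAboveCT_zero_twist (β μ h : ℝ) (K : TrigPolyC4v) (Λ₀ : ℝ) :
    deformedCovAboveCT L M β μ K Λ₀ μ h 0 = hubbardCovAboveCT L M β μ h K Λ₀ := by
  ext X Y
  simp only [deformedCovAboveCT, hubbardCovAboveCT, Matrix.of_apply, deformedCovarianceCT_zero_twist]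

/-- Bare frame: `deformedCovBelowCT … 0 Λ₀ … = deformedCovBelow … Λ₀ …`. [folklore] -/
theorem deformedCovBelowCT_zero_frame (β μ Λ₀ μ' h' a : ℝ) :
    deformedCovBelowCT L M β μ 0 Λ₀ μ' h' a = deformedCovBelow L M β μ Λ₀ μ' h' a := by
  rw [deformedCovBelowCT, deformedCovBelow, deformedCovAboveCT_zero_frame, deformedCovarianceCT_zero_frame]

/-- At zero deformation `C^{K,≤}` is `hubbardCovBelowCT`. [folklore] -/
theorem deformedCovBelowCT_zero_twist (β μ h : ℝ) (K : TrigPolyC4v) (Λ₀ : ℝ) :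
    deformedCovBelowCT L M β μ K Λ₀ μ h 0 = hubbardCovBelowCT L M β μ h K Λ₀ := by
  rw [deformedCovBelowCT, hubbardCovBelowCT, deformedCovAboveCT_zero_twist, deformedCovarianceCT_zero_twist]

variable [NeZero L]

/-- The **deformed CT effective action at scale `Λ₀`**: `effAction` of the CT interaction `V + 𝒩_K` (frame
frozen) with the deformed CT covariance above scale (v1 `deformedEffAction`). [folklore] -/
def deformedEffActionCT (β U μ : ℝ) (K : TrigPolyC4v) (Λ₀ μ' h' a : ℝ) : HubbardGrassmann L M :=
  effAction ℂ (deformedCovAboveCT L M β μ K Λ₀ μ' h' a) (hubbardInteractionCT L M β U K)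

/-- The deformed CT normalised partition function at scale `Λ₀`, `Z^{K,>}_{a,μ',h'} = ∫ dμ_{C^{K,>}} e^{-V_K}`.
[folklore] -/
def deformedEffPartitionFnCT (β U μ : ℝ) (K : TrigPolyC4v) (Λ₀ μ' h' a : ℝ) : ℂ :=
  effPartitionFn ℂ (deformedCovAboveCT L M β μ K Λ₀ μ' h' a) (hubbardInteractionCT L M β U K)

/-- Bare frame: `deformedEffActionCT … 0 Λ₀ … = deformedEffAction … Λ₀ …`. [folklore] -/
theorem deformedEffActionCT_zero_frame (β U μ Λ₀ μ' h' a : ℝ) :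
    deformedEffActionCT L M β U μ 0 Λ₀ μ' h' a = deformedEffAction L M β U μ Λ₀ μ' h' a := by
  rw [deformedEffActionCT, deformedCovAboveCT_zero_frame, hubbardInteractionCT_zero_frame, deformedEffAction]

/-- **At zero deformation the deformed CT effective action is `hubbardEffectiveActionCT`** — the response
coefficients below are derivatives of functionals of the CT effective action itself. [folklore] -/
theorem deformedEffActionCT_zero_twist (β U μ h : ℝ) (K : TrigPolyC4v) (Λ₀ : ℝ) :
    deformedEffActionCT L M β U μ K Λ₀ μ h 0 = hubbardEffectiveActionCT L M β U μ h K Λ₀ := by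
  rw [deformedEffActionCT, deformedCovAboveCT_zero_twist, hubbardEffectiveActionCT]

/-- Bare frame: `deformedEffPartitionFnCT … 0 Λ₀ … = deformedEffPartitionFn … Λ₀ …`. [folklore] -/
theorem deformedEffPartitionFnCT_zero_frame (β U μ Λ₀ μ' h' a : ℝ) :
    deformedEffPartitionFnCT L M β U μ 0 Λ₀ μ' h' a = deformedEffPartitionFn L M β U μ Λ₀ μ' h' a := by
  rw [deformedEffPartitionFnCT, deformedCovAboveCT_zero_frame, hubbardInteractionCT_zero_frame,
    deformedEffPartitionFn]

/-- At zero deformation `Z^{K,>}` is `hubbardEffPartitionFnCT`. [folklore] -/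
theorem deformedEffPartitionFnCT_zero_twist (β U μ h : ℝ) (K : TrigPolyC4v) (Λ₀ : ℝ) :
    deformedEffPartitionFnCT L M β U μ K Λ₀ μ h 0 = hubbardEffPartitionFnCT L M β U μ h K Λ₀ := by
  rw [deformedEffPartitionFnCT, deformedCovAboveCT_zero_twist, hubbardEffPartitionFnCT]

/-- The free (Gaussian) log-determinant of the deformed quadratic Hamiltonian with band `e_K`:
`Σ_k log |det(-iω_k + M^K_{a,μ',h'}(k⃗))|` (v1 `freeLogDet`). [folklore] -/
def freeLogDetCT (β μ' h' : ℝ) (K : TrigPolyC4v) (a : ℝ) : ℝ :=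
  ∑ k : FreqMomentum L M, Real.log ‖deformedNambuDenCT L M β μ' h' K a k‖

/-- Bare frame: `freeLogDetCT … 0 a = freeLogDet … a`. [folklore] -/
theorem freeLogDetCT_zero_frame (β μ' h' a : ℝ) : freeLogDetCT L M β μ' h' 0 a = freeLogDet L M β μ' h' a := by
  simp only [freeLogDetCT, freeLogDet, deformedNambuDenCT_zero_frame]

/-- The **scale-`Λ₀` mean-field free energy per site in the frame `K`** of the deformed seeded Hubbard torus,
`f^K_MF(a, μ', h') = -(βL²)⁻¹ [log N^K + log |Z^{K,>}| + log |∫ dμ_{C^{K,≤}} e^{-𝒢₂}|]` — v1 `mfFreeEnergy`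
(Salmhofer 1999 (2.105)/(4.85): free determinant × above-scale partition function × below-scale integral,
the latter in the QUADRATIC truncation `𝒢 ↦ 𝒢₂ = quadraticPart 𝒢`) with the CT covariance, cutoff and
interaction slot; scale decomposition frozen at `(μ, K, Λ₀)`. Junk `log 0 = 0`. [folklore] -/
def mfFreeEnergyCT (β U μ : ℝ) (K : TrigPolyC4v) (Λ₀ μ' h' a : ℝ) : ℝ :=
  -(1 / (β * (L : ℝ) ^ 2)) *
    (freeLogDetCT L M β μ' h' K a + Real.log ‖deformedEffPartitionFnCT L M β U μ K Λ₀ μ' h' a‖ +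
      Real.log ‖gaussExpect ℂ (deformedCovBelowCT L M β μ K Λ₀ μ' h' a)
        (grassmannExp (-quadraticPart (deformedEffActionCT L M β U μ K Λ₀ μ' h' a)))‖)

/-- Bare frame: `mfFreeEnergyCT … 0 Λ₀ … = mfFreeEnergy … Λ₀ …`. [folklore] -/
theorem mfFreeEnergyCT_zero_frame (β U μ Λ₀ μ' h' a : ℝ) :
    mfFreeEnergyCT L M β U μ 0 Λ₀ μ' h' a = mfFreeEnergy L M β U μ Λ₀ μ' h' a := by
  rw [mfFreeEnergyCT, mfFreeEnergy, freeLogDetCT_zero_frame, deformedEffPartitionFnCT_zero_frame,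
    deformedCovBelowCT_zero_frame, deformedEffActionCT_zero_frame]

/-- The **phase stiffness at scale `Λ₀` in the frame `K`** (finite `L, M, β`): `ρ_s = ∂²_a f^K_MF(a, μ, h)|_{a=0}`
(superfluid weight as static current response, v1 `scaleStiffness`; Xiang–Wu 2022 §9.2). [cite: XiangWu2022, §9.2] -/
def scaleStiffnessCT (β U μ h : ℝ) (K : TrigPolyC4v) (Λ₀ : ℝ) : ℝ :=
  iteratedDeriv 2 (fun a => mfFreeEnergyCT L M β U μ K Λ₀ μ h a) 0

/-- The **pair compressibility at scale `Λ₀` in the frame `K`**: `κ = -∂²_{μ'} f^K_MF(0, μ', h)|_{μ'=μ}` (v1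
`scaleCompressibility`). [folklore] -/
def scaleCompressibilityCT (β U μ h : ℝ) (K : TrigPolyC4v) (Λ₀ : ℝ) : ℝ :=
  -iteratedDeriv 2 (fun μ' => mfFreeEnergyCT L M β U μ K Λ₀ μ' h 0) μ

/-- The **mean-field anomalous `B₁g` density at scale `Λ₀` in the frame `K`**:
`m₀ = -½ ∂_{h'} f^K_MF(0, μ, h')|_{h'=h}`, i.e. `Re⟨Δ_d⟩/L²` of the truncated model, the normalisation of
`dWaveSourceDensity` (v1 `scaleMeanFieldDensity`; Koma–Tasaki 1994 §1). [cite: KomaTasaki1994, §1] -/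
def scaleMeanFieldDensityCT (β U μ h : ℝ) (K : TrigPolyC4v) (Λ₀ : ℝ) : ℝ :=
  -(1 / 2) * deriv (fun h' => mfFreeEnergyCT L M β U μ K Λ₀ μ h' 0) h

/-- Bare frame: `scaleStiffnessCT … 0 Λ₀ = scaleStiffness … Λ₀`. [folklore] -/
theorem scaleStiffnessCT_zero_frame (β U μ h Λ₀ : ℝ) :
    scaleStiffnessCT L M β U μ h 0 Λ₀ = scaleStiffness L M β U μ h Λ₀ := by
  simp only [scaleStiffnessCT, scaleStiffness, mfFreeEnergyCT_zero_frame]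

/-- Bare frame: `scaleCompressibilityCT … 0 Λ₀ = scaleCompressibility … Λ₀`. [folklore] -/
theorem scaleCompressibilityCT_zero_frame (β U μ h Λ₀ : ℝ) :
    scaleCompressibilityCT L M β U μ h 0 Λ₀ = scaleCompressibility L M β U μ h Λ₀ := by
  simp only [scaleCompressibilityCT, scaleCompressibility, mfFreeEnergyCT_zero_frame]

/-- Bare frame: `scaleMeanFieldDensityCT … 0 Λ₀ = scaleMeanFieldDensity … Λ₀`. [folklore] -/
theorem scaleMeanFieldDensityCT_zero_frame (β U μ h Λ₀ : ℝ) :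
    scaleMeanFieldDensityCT L M β U μ h 0 Λ₀ = scaleMeanFieldDensity L M β U μ h Λ₀ := by
  simp only [scaleMeanFieldDensityCT, scaleMeanFieldDensity, mfFreeEnergyCT_zero_frame]

end DeformedCT

/-! ### §3 The quasiparticle normal form against `e_K`: kept Cooper term and scaled remainder norm -/

section NormalFormCT

variable (L M : ℕ) {Np : ℕ}

/-- The static **quasiparticle energy** of a normal form in the frame `K`, `E(k⃗) = √((e_K + n)² + Δ²)` (v1
`modelEnergy` with `ξ ↦ e_K`; the gap function `Δ = hφ_d + a` is v1's `gapFunction`). [folklore] -/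
def modelEnergyCT (μ : ℝ) (K : TrigPolyC4v) (h : ℝ) (q : HubbardNormalForm L Np) (k : TorusSite 2 L) : ℝ :=
  Real.sqrt ((nambuXiCT L μ K k + q.shift k) ^ 2 + gapFunction L h q k ^ 2)

/-- Bare frame: `modelEnergyCT L μ 0 h = modelEnergy L μ h`. [folklore] -/
@[simp] theorem modelEnergyCT_zero_frame (μ h : ℝ) (q : HubbardNormalForm L Np) (k : TorusSite 2 L) :
    modelEnergyCT L μ 0 h q k = modelEnergy L μ h q k := by
  rw [modelEnergyCT, nambuXiCT_zero_frame, modelEnergy]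

variable [NeZero L]

/-- `InFreqShellCT`: the label `k = (ω, k⃗)` is below scale in the frame `K`, `ω² + e_K(k⃗)² < Λ₀²` (exactly
where the below-scale CT weight `1 - χ₂((ω² + e_K²)/Λ₀²)` is positive). [folklore] -/
def InFreqShellCT (β μ : ℝ) (K : TrigPolyC4v) (Λ₀ : ℝ) (k : FreqMomentum L M) : Prop :=
  matsubaraFreq β M k.1 ^ 2 + nambuXiCT L μ K k.2 ^ 2 < Λ₀ ^ 2

omit [NeZero L] in
/-- Bare frame: `InFreqShellCT … 0 Λ₀ k ↔ InFreqShell … Λ₀ k`. [folklore] -/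
theorem inFreqShellCT_zero_frame (β μ Λ₀ : ℝ) (k : FreqMomentum L M) :
    InFreqShellCT L M β μ 0 Λ₀ k ↔ InFreqShell L M β μ Λ₀ k := by
  rw [InFreqShellCT, nambuXiCT_zero_frame, InFreqShell]

open Classical in
/-- The below-scale (frame `K`) singlet pairs with pair label `q = k₁ + k₂`. [folklore] -/
def shellPairsCT (β μ : ℝ) (K : TrigPolyC4v) (Λ₀ : ℝ) (k₁ k₂ : FreqMomentum L M) :
    Finset (FreqMomentum L M × FreqMomentum L M) :=
  Finset.univ.filter fun kk =>
    pairLabel L M kk.1 kk.2 = pairLabel L M k₁ k₂ ∧ InFreqShellCT L M β μ K Λ₀ kk.1 ∧ InFreqShellCT L M β μ K Λ₀ kk.2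

/-- Bare frame: `shellPairsCT … 0 Λ₀ = shellPairs … Λ₀`. [folklore] -/
@[simp] theorem shellPairsCT_zero_frame (β μ Λ₀ : ℝ) (k₁ k₂ : FreqMomentum L M) :
    shellPairsCT L M β μ 0 Λ₀ k₁ k₂ = shellPairs L M β μ Λ₀ k₁ k₂ := by
  ext kk
  simp [shellPairsCT, shellPairs, inFreqShellCT_zero_frame]

/-- The **`B₁g` Cooper-channel coefficient in the frame `K`**, `D̂_F(q)`: the projection of the reduced singlet
Cooper vertex (`cooperVertex`, unchanged), restricted to below-scale legs of the frame, onto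
`pairFormFactor ⊗ pairFormFactor` (v1 `cooperCoefficient`; junk `0` when no below-scale pair of label `q`
exists). [folklore] -/
def cooperCoefficientCT (β μ : ℝ) (K : TrigPolyC4v) (Λ₀ : ℝ) (F : HubbardGrassmann L M)
    (k₁ k₂ : FreqMomentum L M) : ℂ :=
  (∑ kk ∈ shellPairsCT L M β μ K Λ₀ k₁ k₂, ∑ pp ∈ shellPairsCT L M β μ K Λ₀ k₁ k₂,
      ((pairFormFactor L M kk.1 kk.2 * pairFormFactor L M pp.1 pp.2 : ℝ) : ℂ) *
        cooperVertex L M β F kk.1 kk.2 pp.1 pp.2) /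
    ((∑ kk ∈ shellPairsCT L M β μ K Λ₀ k₁ k₂, pairFormFactor L M kk.1 kk.2 ^ 2 : ℝ) : ℂ) ^ 2

/-- Bare frame: `cooperCoefficientCT … 0 Λ₀ = cooperCoefficient … Λ₀`. [folklore] -/
@[simp] theorem cooperCoefficientCT_zero_frame (β μ Λ₀ : ℝ) (F : HubbardGrassmann L M) (k₁ k₂ : FreqMomentum L M) :
    cooperCoefficientCT L M β μ 0 Λ₀ F k₁ k₂ = cooperCoefficient L M β μ Λ₀ F k₁ k₂ := by
  rw [cooperCoefficientCT, shellPairsCT_zero_frame, cooperCoefficient]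

open Classical in
/-- The **kept Cooper term in the frame `K`**, `𝒦^K(F)`: the `B₁g` spin-singlet Cooper-channel part of the
quartic part of `F` among legs below scale in the frame (v1 `cooperKept` with `InFreqShell ↦ InFreqShellCT`).
[folklore] -/
def cooperKeptCT (β μ : ℝ) (K : TrigPolyC4v) (Λ₀ : ℝ) (F : HubbardGrassmann L M) : HubbardGrassmann L M :=
  ∑ k₁ : FreqMomentum L M, ∑ k₂ : FreqMomentum L M, ∑ k₃ : FreqMomentum L M, ∑ k₄ : FreqMomentum L M,
    if pairLabel L M k₁ k₂ = pairLabel L M k₃ k₄ ∧ InFreqShellCT L M β μ K Λ₀ k₁ ∧ InFreqShellCT L M β μ K Λ₀ k₂ ∧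
        InFreqShellCT L M β μ K Λ₀ k₃ ∧ InFreqShellCT L M β μ K Λ₀ k₄ then
      ((((1 / (β * (L : ℝ) ^ 2)) ^ 3 : ℝ) : ℂ) * cooperCoefficientCT L M β μ K Λ₀ F k₁ k₂ *
          ((pairFormFactor L M k₁ k₂ * pairFormFactor L M k₃ k₄ : ℝ) : ℂ)) •
        (psiPlus k₁ 0 * psiPlus k₂ 1 * psiMinus k₄ 1 * psiMinus k₃ 0)
    else 0

/-- Bare frame: `cooperKeptCT … 0 Λ₀ = cooperKept … Λ₀`. [folklore] -/
theorem cooperKeptCT_zero_frame (β μ Λ₀ : ℝ) (F : HubbardGrassmann L M) :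
    cooperKeptCT L M β μ 0 Λ₀ F = cooperKept L M β μ Λ₀ F := by
  classical
  simp only [cooperKeptCT, cooperKept, inFreqShellCT_zero_frame, cooperCoefficientCT_zero_frame]

/-- The **CT shell leg weight** `√(1 - w^K_{Λ₀}(k_X))` of a field label (`w^K = hubbardCutoffWeightCT` at the
reference `(μ, K, Λ₀)`). [folklore] -/
def shellLegWeightCT (β μ : ℝ) (K : TrigPolyC4v) (Λ₀ : ℝ) (X : HubbardFieldIdx L M) : ℝ :=
  Real.sqrt (1 - hubbardCutoffWeightCT L M β μ K Λ₀ (momentumOf L M X))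

/-- The **CT energy leg weight** `√((1 - w^K_{Λ₀}(k_X)) · Λ₀ / max(Λ₀, E(k⃗_X)))`, `E = modelEnergyCT`. [folklore] -/
def energyLegWeightCT (β μ h : ℝ) (K : TrigPolyC4v) (Λ₀ : ℝ) (q : HubbardNormalForm L Np) (X : HubbardFieldIdx L M) : ℝ :=
  Real.sqrt ((1 - hubbardCutoffWeightCT L M β μ K Λ₀ (momentumOf L M X)) *
    (Λ₀ / max Λ₀ (modelEnergyCT L μ K h q (momentumOf L M X).2)))

omit [NeZero L] in
/-- Bare frame: `shellLegWeightCT … 0 Λ₀ = shellLegWeight … Λ₀` (as functions of the label). [folklore] -/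
@[simp] theorem shellLegWeightCT_zero_frame (β μ Λ₀ : ℝ) :
    shellLegWeightCT L M β μ 0 Λ₀ = shellLegWeight L M β μ Λ₀ := by
  funext X
  rw [shellLegWeightCT, hubbardCutoffWeightCT_zero_frame, shellLegWeight]

omit [NeZero L] in
/-- Bare frame: `energyLegWeightCT … 0 Λ₀ q = energyLegWeight … Λ₀ q` (as functions of the label). [folklore] -/
@[simp] theorem energyLegWeightCT_zero_frame (β μ h Λ₀ : ℝ) (q : HubbardNormalForm L Np) :
    energyLegWeightCT L M β μ h 0 Λ₀ q = energyLegWeight L M β μ h Λ₀ q := by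
  funext X
  rw [energyLegWeightCT, hubbardCutoffWeightCT_zero_frame, modelEnergyCT_zero_frame, energyLegWeight]

/-- The **CT remainder** of the effective action at scale `Λ₀` w.r.t. the normal-form data `q`:
`𝒢^K - 𝒬(q) - 𝒦^K(𝒢^K)`, `𝒢^K = hubbardEffectiveActionCT L M β U μ h K Λ₀` (v1 `remainderOf`; the quadratic
quasiparticle form `𝒬(q) = normalFormQuadratic` is unchanged — its normal shift `n` is what absorbs the static
quadratic kernel an imperfect frame leaves). [folklore] -/
def remainderOfCT (β U μ h : ℝ) (K : TrigPolyC4v) (Λ₀ : ℝ) (q : HubbardNormalForm L Np) : HubbardGrassmann L M :=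
  hubbardEffectiveActionCT L M β U μ h K Λ₀ - normalFormQuadratic L M β q -
    cooperKeptCT L M β μ K Λ₀ (hubbardEffectiveActionCT L M β U μ h K Λ₀)

/-- Bare frame: `remainderOfCT … 0 Λ₀ q = remainderOf … Λ₀ q`. [folklore] -/
theorem remainderOfCT_zero_frame (β U μ h Λ₀ : ℝ) (q : HubbardNormalForm L Np) :
    remainderOfCT L M β U μ h 0 Λ₀ q = remainderOf L M β U μ h Λ₀ q := by
  rw [remainderOfCT, hubbardEffectiveActionCT_zero_frame, cooperKeptCT_zero_frame, remainderOf]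

/-- The **CT scaled remainder norm** `η^K(q) = Σ_m Λ₀^{-(2m-3)} ‖R_m‖_m` of `R = 𝒢^K - 𝒬(q) - 𝒦^K(𝒢^K)`:
Salmhofer's leg-weighted `L¹–L^∞` norms (`legKernelNorm`, Salmhofer 1998 §4.1) of the kernels
`weightedKernel ε R m`, with `shellLegWeightCT` in degree `2` and `energyLegWeightCT` otherwise, normalisation
exponents `2m - 3` (v1 `scaledRemainderNorm`, verbatim). [cite: Salmhofer1998, §4.1 (norm before Lemma 1)] -/
def scaledRemainderNormCT (β U μ h : ℝ) (K : TrigPolyC4v) (Λ₀ : ℝ) (q : HubbardNormalForm L Np) : ℝ :=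
  ∑ m ∈ Finset.range (Fintype.card (HubbardFieldIdx L M) + 1),
    Λ₀ ^ (-(2 * (m : ℤ) - 3)) *
      legKernelNorm (if m = 2 then shellLegWeightCT L M β μ K Λ₀ else energyLegWeightCT L M β μ h K Λ₀ q)
        (1 / (β * (L : ℝ) ^ 2)) m
        (weightedKernel (1 / (β * (L : ℝ) ^ 2)) (remainderOfCT L M β U μ h K Λ₀ q) m)

/-- Bare frame: **`scaledRemainderNormCT … 0 Λ₀ q = scaledRemainderNorm … Λ₀ q`**. [folklore] -/
theorem scaledRemainderNormCT_zero_frame (β U μ h Λ₀ : ℝ) (q : HubbardNormalForm L Np) :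
    scaledRemainderNormCT L M β U μ h 0 Λ₀ q = scaledRemainderNorm L M β U μ h Λ₀ q := by
  simp only [scaledRemainderNormCT, scaledRemainderNorm, shellLegWeightCT_zero_frame, energyLegWeightCT_zero_frame,
    remainderOfCT_zero_frame]

omit [NeZero L] in
/-- The CT shell leg weights are nonnegative. [folklore] -/
theorem shellLegWeightCT_nonneg (β μ : ℝ) (K : TrigPolyC4v) (Λ₀ : ℝ) (X : HubbardFieldIdx L M) :
    0 ≤ shellLegWeightCT L M β μ K Λ₀ X :=
  Real.sqrt_nonneg _

omit [NeZero L] in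
/-- The CT energy leg weights are nonnegative. [folklore] -/
theorem energyLegWeightCT_nonneg (β μ h : ℝ) (K : TrigPolyC4v) (Λ₀ : ℝ) (q : HubbardNormalForm L Np)
    (X : HubbardFieldIdx L M) : 0 ≤ energyLegWeightCT L M β μ h K Λ₀ q X :=
  Real.sqrt_nonneg _

/-- **The CT scaled remainder norm is nonnegative** (`β > 0`, `Λ₀ ≥ 0`). [folklore] -/
theorem scaledRemainderNormCT_nonneg {β Λ₀ : ℝ} (hβ : 0 < β) (hΛ : 0 ≤ Λ₀) (U μ h : ℝ) (K : TrigPolyC4v)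
    (q : HubbardNormalForm L Np) : 0 ≤ scaledRemainderNormCT L M β U μ h K Λ₀ q := by
  refine Finset.sum_nonneg fun m _ => mul_nonneg (zpow_nonneg hΛ _) (legKernelNorm_nonneg ?_ ?_ _ _)
  · intro X
    split_ifs
    · exact shellLegWeightCT_nonneg L M β μ K Λ₀ X
    · exact energyLegWeightCT_nonneg L M β μ h K Λ₀ q X
  · have hL : (0 : ℝ) < (L : ℝ) := by exact_mod_cast Nat.pos_of_ne_zero (NeZero.ne L)
    positivity

end NormalFormCT

/-! ### §4 The CT normal-form predicate `IsRealisedAtCT` -/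

section ReportCT

variable (L M : ℕ) [NeZero L] {Np : ℕ}

/-- `GapConditionCT`: the number `g` reports the gap function `Δ = gapFunction L h q` on the CT patch-shell
`S^K_i` in the MIN-MODULUS sense (v1 `GapCondition` on `patchShellCT`): `g = 0` if `S^K_i = ∅`, otherwise `g`
is a value of `Δ` on `S^K_i` of least modulus. [folklore] -/
def GapConditionCT (μ : ℝ) (K : TrigPolyC4v) (h Λ₀ : ℝ) (q : HubbardNormalForm L Np) (i : Fin Np) (g : ℝ) : Prop :=
  (patchShellCT L μ K Λ₀ Np i = ∅ → g = 0) ∧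
    (patchShellCT L μ K Λ₀ Np i ≠ ∅ → ∃ k ∈ patchShellCT L μ K Λ₀ Np i, g = gapFunction L h q k) ∧
    ∀ k ∈ patchShellCT L μ K Λ₀ Np i, |g| ≤ |gapFunction L h q k|

/-- `SignConditionCT`: the gap function has a constant sign on the CT patch-shell `S^K_i` (v1
`SignCondition`). [folklore] -/
def SignConditionCT (μ : ℝ) (K : TrigPolyC4v) (h Λ₀ : ℝ) (q : HubbardNormalForm L Np) (i : Fin Np) : Prop :=
  ∀ k ∈ patchShellCT L μ K Λ₀ Np i, ∀ k' ∈ patchShellCT L μ K Λ₀ Np i,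
    0 ≤ gapFunction L h q k * gapFunction L h q k'

/-- `NodalConditionCT`: on the CT patch-shell of a patch DECLARED NODAL the normal form is a pinned Dirac
cone about the CT reference node `κ^K_i` in the tangential coordinate `t = tangentialCoordCT`: `z ≡ z_i`,
`Δ = v_a t + d₃ t³`, `e_K + n = s + (1 + r) e_K + c₂ t² + c₄ t⁴` (even profile on the renormalised band),
`1 + z_i > 0`, `1 + r_i > 0`, and the reported velocities are the cone's:
`v_F = (1 + r_i) |∇e^c_K(κ^K_i)| / (1 + z_i)`, `v_Δ = |v_a| / (1 + z_i)` (v1 `NodalCondition` with `ξ ↦ e_K`;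
Xiang–Wu 2022 §7.3). [cite: XiangWu2022, §7.3] -/
def NodalConditionCT (μ : ℝ) (K : TrigPolyC4v) (h Λ₀ : ℝ) (q : HubbardNormalForm L Np) (i : Fin Np)
    (vF vΔ : ℝ) : Prop :=
  0 < 1 + q.nodeZ i ∧ 0 < 1 + q.nodeR i ∧
    (∀ k ∈ patchShellCT L μ K Λ₀ Np i,
      q.zren k = q.nodeZ i ∧
        gapFunction L h q k =
          q.nodeVa i * tangentialCoordCT L μ K Np i k + q.nodeD₃ i * tangentialCoordCT L μ K Np i k ^ 3 ∧
        nambuXiCT L μ K k + q.shift k =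
          q.nodeS i + (1 + q.nodeR i) * nambuXiCT L μ K k + q.nodeC₂ i * tangentialCoordCT L μ K Np i k ^ 2 +
            q.nodeC₄ i * tangentialCoordCT L μ K Np i k ^ 4) ∧
    vF = (1 + q.nodeR i) * fermiSpeedCT K (nodePointCT μ K Np i) / (1 + q.nodeZ i) ∧
    vΔ = |q.nodeVa i| / (1 + q.nodeZ i)

/-- **`IsRealisedAtCT L M β U μ h K Λ₀ Np nodal p`: the parameter tuple `p` is realised by the scale-`Λ₀`
effective action of the seeded Hubbard torus IN THE FRAME `K` at `(L, β)` with `2M` Matsubara frequencies**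
— v1's `IsRealisedAt` with `hubbardEffectiveAction ↦ hubbardEffectiveActionCT … K Λ₀` and `ξ ↦ e_K`
everywhere: `β > 0` and there are parity-even normal-form data `q` with (gap) min-modulus gap reports on the
CT patch-shells and constant gap sign off the nodal set, (cones) pinned Dirac cones with velocities
`(p.fermiVelocity, p.gapVelocity)` on the nodal set, (responses) `p.stiffness`, `p.compressibility`,
`p.meanFieldDensity` ARE the CT scale-`Λ₀` response coefficients, (remainder) `η^K(q) ≤ p.remainderNorm`.
[folklore] -/
def IsRealisedAtCT (β U μ h : ℝ) (K : TrigPolyC4v) (Λ₀ : ℝ) (Np : ℕ) (nodal : Finset (Fin Np))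
    (p : HubbardScaleData.Parameters Np) : Prop :=
  0 < β ∧ ∃ q : HubbardNormalForm L Np,
    q.IsEven ∧
    (∀ i, GapConditionCT L μ K h Λ₀ q i (p.gap i)) ∧
    (∀ i ∉ nodal, SignConditionCT L μ K h Λ₀ q i) ∧
    (∀ i ∈ nodal, NodalConditionCT L μ K h Λ₀ q i p.fermiVelocity p.gapVelocity) ∧
    p.stiffness = scaleStiffnessCT L M β U μ h K Λ₀ ∧
    p.compressibility = scaleCompressibilityCT L M β U μ h K Λ₀ ∧
    p.meanFieldDensity = scaleMeanFieldDensityCT L M β U μ h K Λ₀ ∧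
    scaledRemainderNormCT L M β U μ h K Λ₀ q ≤ p.remainderNorm

variable {L M}

/-- Bare frame: `GapConditionCT L μ 0 h Λ₀ ↔ GapCondition L μ h Λ₀`. [folklore] -/
theorem gapConditionCT_zero_frame (μ h Λ₀ : ℝ) (q : HubbardNormalForm L Np) (i : Fin Np) (g : ℝ) :
    GapConditionCT L μ 0 h Λ₀ q i g ↔ GapCondition L μ h Λ₀ q i g := by
  simp only [GapConditionCT, GapCondition, patchShellCT_zero_frame]

/-- Bare frame: `SignConditionCT L μ 0 h Λ₀ ↔ SignCondition L μ h Λ₀`. [folklore] -/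
theorem signConditionCT_zero_frame (μ h Λ₀ : ℝ) (q : HubbardNormalForm L Np) (i : Fin Np) :
    SignConditionCT L μ 0 h Λ₀ q i ↔ SignCondition L μ h Λ₀ q i := by
  simp only [SignConditionCT, SignCondition, patchShellCT_zero_frame]

/-- Bare frame: `NodalConditionCT L μ 0 h Λ₀ ↔ NodalCondition L μ h Λ₀`. [folklore] -/
theorem nodalConditionCT_zero_frame (μ h Λ₀ : ℝ) (q : HubbardNormalForm L Np) (i : Fin Np) (vF vΔ : ℝ) :
    NodalConditionCT L μ 0 h Λ₀ q i vF vΔ ↔ NodalCondition L μ h Λ₀ q i vF vΔ := by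
  simp only [NodalConditionCT, NodalCondition, patchShellCT_zero_frame, tangentialCoordCT_zero_frame,
    nambuXiCT_zero_frame, fermiSpeedCT_zero_frame, nodePointCT_zero_frame]

/-- **Bare frame: `IsRealisedAtCT … 0 Λ₀ … p ↔ IsRealisedAt … Λ₀ … p`** — in the frame `K = 0` the CT
predicate IS v1's predicate (every component reduces: `…_zero_frame`). [folklore] -/
theorem isRealisedAtCT_zero_frame_iff (β U μ h Λ₀ : ℝ) (nodal : Finset (Fin Np))
    (p : HubbardScaleData.Parameters Np) :
    IsRealisedAtCT L M β U μ h 0 Λ₀ Np nodal p ↔ IsRealisedAt L M β U μ h Λ₀ Np nodal p := by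
  simp only [IsRealisedAtCT, IsRealisedAt, gapConditionCT_zero_frame, signConditionCT_zero_frame,
    nodalConditionCT_zero_frame, scaleStiffnessCT_zero_frame, scaleCompressibilityCT_zero_frame,
    scaleMeanFieldDensityCT_zero_frame, scaledRemainderNormCT_zero_frame]

/-- A CT-realised tuple is realised at positive temperature parameter `β > 0`. [folklore] -/
theorem IsRealisedAtCT.beta_pos {β U μ h Λ₀ : ℝ} {K : TrigPolyC4v} {nodal : Finset (Fin Np)}
    {p : HubbardScaleData.Parameters Np} (hp : IsRealisedAtCT L M β U μ h K Λ₀ Np nodal p) : 0 < β :=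
  hp.1

/-- A CT-realised tuple has a nonnegative remainder norm (`Λ₀ ≥ 0`). [folklore] -/
theorem IsRealisedAtCT.remainderNorm_nonneg {β U μ h Λ₀ : ℝ} {K : TrigPolyC4v} {nodal : Finset (Fin Np)}
    {p : HubbardScaleData.Parameters Np} (hΛ : 0 ≤ Λ₀) (hp : IsRealisedAtCT L M β U μ h K Λ₀ Np nodal p) :
    0 ≤ p.remainderNorm := by
  obtain ⟨hβ, q, -, -, -, -, -, -, -, hη⟩ := hp
  exact (scaledRemainderNormCT_nonneg L M hβ hΛ U μ h K q).trans hη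

/-- **Min-modulus semantics**: a reported gap bounds the gap function from below in modulus on the whole CT
patch-shell. [folklore] -/
theorem GapConditionCT.abs_le_abs {μ : ℝ} {K : TrigPolyC4v} {h Λ₀ : ℝ} {q : HubbardNormalForm L Np} {i : Fin Np}
    {g : ℝ} (hg : GapConditionCT L μ K h Λ₀ q i g) {k : TorusSite 2 L} (hk : k ∈ patchShellCT L μ K Λ₀ Np i) :
    |g| ≤ |gapFunction L h q k| :=
  hg.2.2 k hk

/-- On an empty CT patch-shell the reported gap is `0` (no vacuous certification of a gap, in any frame).
[folklore] -/
theorem GapConditionCT.eq_zero {μ : ℝ} {K : TrigPolyC4v} {h Λ₀ : ℝ} {q : HubbardNormalForm L Np} {i : Fin Np}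
    {g : ℝ} (hg : GapConditionCT L μ K h Λ₀ q i g) (he : patchShellCT L μ K Λ₀ Np i = ∅) : g = 0 :=
  hg.1 he

/-- What a consumer extracts from a CT-realised tuple: parity-even normal-form data whose gap function
dominates the reported gaps in modulus on every CT patch-shell, with the sign / nodal clauses and the
remainder bound. [folklore] -/
theorem IsRealisedAtCT.exists_normalForm {β U μ h Λ₀ : ℝ} {K : TrigPolyC4v} {nodal : Finset (Fin Np)}
    {p : HubbardScaleData.Parameters Np} (hp : IsRealisedAtCT L M β U μ h K Λ₀ Np nodal p) :
    ∃ q : HubbardNormalForm L Np, q.IsEven ∧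
      (∀ i, ∀ k ∈ patchShellCT L μ K Λ₀ Np i, |p.gap i| ≤ |gapFunction L h q k|) ∧
      (∀ i ∉ nodal, SignConditionCT L μ K h Λ₀ q i) ∧
      (∀ i ∈ nodal, NodalConditionCT L μ K h Λ₀ q i p.fermiVelocity p.gapVelocity) ∧
      scaledRemainderNormCT L M β U μ h K Λ₀ q ≤ p.remainderNorm := by
  obtain ⟨-, q, heven, hgap, hsign, hnod, -, -, -, hη⟩ := hp
  exact ⟨q, heven, fun i k hk => (hgap i).abs_le_abs hk, hsign, hnod, hη⟩

variable (L M)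

/-- **Non-vacuity of the CT predicate**: at `U = 0`, in the bare frame and with no patches, the free seeded
torus realises its mean-field responses with zero remainder, for every `L ≥ 1`, `M`, `β > 0` (v1
`isRealisedAt_free_noPatch` transported by `isRealisedAtCT_zero_frame_iff`). [folklore] -/
theorem isRealisedAtCT_free_noPatch {β : ℝ} (hβ : 0 < β) (μ h Λ₀ : ℝ) :
    IsRealisedAtCT L M β 0 μ h 0 Λ₀ 0 ∅ (freeNoPatchTuple L M β μ h Λ₀) :=
  (isRealisedAtCT_zero_frame_iff β 0 μ h Λ₀ ∅ _).2 (isRealisedAt_free_noPatch L M hβ μ h Λ₀)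

end ReportCT

/-! ### §5 The report -/

section TheReportCT

variable {Np : ℕ}

/-- **The CT scale report** for general scale data `(Λ₀, Np, nodal)`: at `(L, β)` the set of parameter tuples
`p` such that for every `δ > 0`, FREQUENTLY in the Matsubara count `M → ∞`, SOME ADMISSIBLE FRAME `K` realises a
tuple `δ`-close to `p` at `(L, M, β)` — the Kuratowski upper limit in `M` (as v1) of the realised sets
`⋃_{K admissible} {p | IsRealisedAtCT L M β U μ h K Λ₀ Np nodal p}` (the frame `∃`-bound INSIDE the realised
set, request item (1)); empty for `L = 0`. [folklore] -/
def hubbardScaleReportCTAt (U μ h Λ₀ : ℝ) (Np : ℕ) (nodal : Finset (Fin Np)) : HubbardScaleData.Report Np :=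
  fun L β =>
    if hL : L = 0 then ∅
    else
      haveI : NeZero L := ⟨hL⟩
      {p | ∀ δ : ℝ, 0 < δ → ∃ᶠ M in atTop, ∃ K : TrigPolyC4v, IsAdmissibleFrame K ∧
        ∃ p' : HubbardScaleData.Parameters Np, IsRealisedAtCT L M β U μ h K Λ₀ Np nodal p' ∧ p.IsClose p' δ}

/-- **`hubbardScaleReportCT U μ D h`** — the model report binding a scale datum `D` to the seeded
grand-canonical Hubbard torus `dWaveSourceTorus L U μ h` through its COUNTERTERMED effective action
(definition request `defn-hubbardScaleReportCT` of route HubbardSuperconductivity/AposterioriCapRg): the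
report `hubbardScaleReportCTAt U μ h D.scale D.numPatches D.nodal` of `hubbardEffectiveActionCT L M β U μ h K D.scale`
over admissible frames `K`; it depends on `D` only through its scale, its number of patches and its nodal set.
With it the route's cruxes read `… ∀ h ∈ Set.Ioc 0 h₀, ∃ L₀, D.IsCertifiedEnclosure (hubbardScaleReportCT U μ D h) L₀ …`.
[folklore] -/
def hubbardScaleReportCT (U μ : ℝ) (D : HubbardScaleData) (h : ℝ) : HubbardScaleData.Report D.numPatches :=
  hubbardScaleReportCTAt U μ h (D.scale : ℝ) D.numPatches D.nodal

/-! ### §6 API -/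

/-- Unfolding `hubbardScaleReportCT`: the CT report at the datum's scale, patch number and nodal set.
[folklore] -/
theorem hubbardScaleReportCT_eq (U μ h : ℝ) (D : HubbardScaleData) :
    hubbardScaleReportCT U μ D h = hubbardScaleReportCTAt U μ h (D.scale : ℝ) D.numPatches D.nodal := rfl

/-- Two scale data with the same scale, patch number and nodal set have the same CT report (the report never
reads the enclosures it is certified against). [folklore] -/
theorem hubbardScaleReportCT_congr (U μ h : ℝ) {D D' : HubbardScaleData} (hs : D.scale = D'.scale)
    (hn : D.numPatches = D'.numPatches) (hnod : D.nodal = hn ▸ D'.nodal) :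
    hubbardScaleReportCT U μ D h = hn ▸ hubbardScaleReportCT U μ D' h := by
  cases D; cases D'; cases hn; cases hs; cases hnod; rfl

/-- On the degenerate torus `L = 0` the CT report is empty. [folklore] -/
@[simp] theorem hubbardScaleReportCTAt_zero_length (U μ h Λ₀ : ℝ) (nodal : Finset (Fin Np)) (β : ℝ) :
    hubbardScaleReportCTAt U μ h Λ₀ Np nodal 0 β = ∅ := dif_pos rfl

/-- Membership in the CT report for `L ≥ 1`. [folklore] -/
theorem mem_hubbardScaleReportCTAt_iff (U μ h Λ₀ : ℝ) (nodal : Finset (Fin Np)) (L : ℕ) [NeZero L] (β : ℝ)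
    (p : HubbardScaleData.Parameters Np) :
    p ∈ hubbardScaleReportCTAt U μ h Λ₀ Np nodal L β ↔
      ∀ δ : ℝ, 0 < δ → ∃ᶠ M in atTop, ∃ K : TrigPolyC4v, IsAdmissibleFrame K ∧
        ∃ p' : HubbardScaleData.Parameters Np, IsRealisedAtCT L M β U μ h K Λ₀ Np nodal p' ∧ p.IsClose p' δ := by
  simp only [hubbardScaleReportCTAt, dif_neg (NeZero.ne L)]
  rfl

/-- A tuple realised in ONE admissible frame for all large `M` is reported (the simplest way into the upper
limit). [folklore] -/
theorem mem_hubbardScaleReportCTAt_of_eventually {U μ h Λ₀ : ℝ} {nodal : Finset (Fin Np)} {L : ℕ} [NeZero L]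
    {β : ℝ} {K : TrigPolyC4v} (hK : IsAdmissibleFrame K) {p : HubbardScaleData.Parameters Np}
    (hp : ∀ᶠ M in atTop, IsRealisedAtCT L M β U μ h K Λ₀ Np nodal p) :
    p ∈ hubbardScaleReportCTAt U μ h Λ₀ Np nodal L β := by
  rw [mem_hubbardScaleReportCTAt_iff]
  intro δ hδ
  exact (hp.mono fun M hM => ⟨K, hK, p, hM, HubbardScaleData.Parameters.isClose_self p hδ⟩).frequently

/-- For `β ≤ 0` the CT report is empty (the predicate asks `0 < β`). [folklore] -/
theorem hubbardScaleReportCTAt_of_nonpos (U μ h Λ₀ : ℝ) (nodal : Finset (Fin Np)) (L : ℕ) {β : ℝ} (hβ : β ≤ 0) :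
    hubbardScaleReportCTAt U μ h Λ₀ Np nodal L β = ∅ := by
  rcases Nat.eq_zero_or_pos L with rfl | hL
  · simp
  · haveI : NeZero L := NeZero.of_pos hL
    ext p
    simp only [Set.mem_empty_iff_false, iff_false]
    intro hp
    rw [mem_hubbardScaleReportCTAt_iff] at hp
    obtain ⟨M, K, -, p', hp', -⟩ := (hp 1 one_pos).exists
    exact absurd hp'.beta_pos (not_lt.2 hβ)

/-- **Reported tuples have a nonnegative remainder norm** (`Λ₀ ≥ 0`). [folklore] -/
theorem remainderNorm_nonneg_of_mem_reportCT {U μ h Λ₀ : ℝ} (hΛ : 0 ≤ Λ₀) {nodal : Finset (Fin Np)} {L : ℕ}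
    {β : ℝ} {p : HubbardScaleData.Parameters Np} (hp : p ∈ hubbardScaleReportCTAt U μ h Λ₀ Np nodal L β) :
    0 ≤ p.remainderNorm := by
  rcases Nat.eq_zero_or_pos L with rfl | hL
  · simp at hp
  · haveI : NeZero L := NeZero.of_pos hL
    rw [mem_hubbardScaleReportCTAt_iff] at hp
    refine le_of_forall_pos_lt_add fun δ hδ => ?_
    obtain ⟨M, K, -, p', hp', hclose⟩ := (hp δ hδ).exists
    have h1 := hp'.remainderNorm_nonneg hΛ
    have h2 := hclose.2.2.2.2.2.1
    rw [abs_lt] at h2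
    linarith

/-- **The CT report is not the universal report**: no tuple with negative remainder norm is ever reported.
[folklore] -/
theorem hubbardScaleReportCT_ne_univ (U μ h : ℝ) (D : HubbardScaleData) (L : ℕ) (β : ℝ) :
    hubbardScaleReportCT U μ D h L β ≠ Set.univ := by
  intro huniv
  have hmem : (⟨fun _ => 0, 0, 0, 0, 0, -1, 0⟩ : HubbardScaleData.Parameters D.numPatches) ∈
      hubbardScaleReportCT U μ D h L β := by
    rw [huniv]; exact Set.mem_univ _
  have := remainderNorm_nonneg_of_mem_reportCT (by exact_mod_cast D.scale_pos.le) hmem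
  norm_num at this

/-- A datum whose remainder enclosure lies below `0` is never a certified enclosure of the CT report.
[folklore] -/
theorem not_isCertifiedEnclosure_reportCT_of_remainderNorm_snd_neg (U μ h : ℝ) (D : HubbardScaleData)
    (hD : D.remainderNorm.snd < 0) (L₀ : ℕ) :
    ¬ D.IsCertifiedEnclosure (hubbardScaleReportCT U μ D h) L₀ := by
  intro hcert
  obtain ⟨β₀, hβ₀⟩ := hcert L₀ le_rfl
  obtain ⟨p, hp, henc⟩ := hβ₀ β₀ le_rfl
  have h0 := remainderNorm_nonneg_of_mem_reportCT (by exact_mod_cast D.scale_pos.le) hp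
  obtain ⟨-, -, -, -, -, hη, -⟩ := henc
  rw [NonemptyInterval.mem_ratCast_iff] at hη
  have : (D.remainderNorm.snd : ℝ) < 0 := by exact_mod_cast hD
  linarith [hη.2]

/-- **Not certified if empty**: if at some volume `L ≥ L₀` the CT report is empty for arbitrarily large `β`,
the datum is not a certified enclosure from `L₀` on (no vacuity through the report; cf.
`HubbardScaleData.not_isCertifiedEnclosure_empty`). [folklore] -/
theorem not_isCertifiedEnclosure_reportCT_of_empty (U μ h : ℝ) (D : HubbardScaleData) {L₀ L : ℕ} (hL : L₀ ≤ L)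
    (hempty : ∀ β₀ : ℝ, ∃ β, β₀ ≤ β ∧ hubbardScaleReportCT U μ D h L β = ∅) :
    ¬ D.IsCertifiedEnclosure (hubbardScaleReportCT U μ D h) L₀ := by
  intro hcert
  obtain ⟨β₀, hβ₀⟩ := hcert L hL
  obtain ⟨β, hβ, he⟩ := hempty β₀
  obtain ⟨p, hp, -⟩ := hβ₀ β hβ
  rw [he] at hp
  exact hp

/-- **v1 inside v2**: the bare-frame report is contained in the CT report (`K = 0` is admissible and
`IsRealisedAtCT … 0 … ↔ IsRealisedAt …`), for general scale data. [folklore] -/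
theorem hubbardScaleReportAt_subset_CT (U μ h Λ₀ : ℝ) (nodal : Finset (Fin Np)) (L : ℕ) (β : ℝ) :
    hubbardScaleReportAt U μ h Λ₀ Np nodal L β ⊆ hubbardScaleReportCTAt U μ h Λ₀ Np nodal L β := by
  rcases Nat.eq_zero_or_pos L with rfl | hL
  · simp
  · haveI : NeZero L := NeZero.of_pos hL
    intro p hp
    rw [mem_hubbardScaleReportAt_iff] at hp
    rw [mem_hubbardScaleReportCTAt_iff]
    intro δ hδ
    refine (hp δ hδ).mono fun M hM => ?_
    obtain ⟨p', hp', hclose⟩ := hM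
    exact ⟨0, isAdmissibleFrame_zero, p', (isRealisedAtCT_zero_frame_iff β U μ h Λ₀ nodal p').2 hp', hclose⟩

/-- **`hubbardScaleReport_subset_CT`** (requirement (b) of the request): for every datum `D`,
`hubbardScaleReport U μ D h L β ⊆ hubbardScaleReportCT U μ D h L β`. [folklore] -/
theorem hubbardScaleReport_subset_CT (U μ : ℝ) (D : HubbardScaleData) (h : ℝ) (L : ℕ) (β : ℝ) :
    hubbardScaleReport U μ D h L β ⊆ hubbardScaleReportCT U μ D h L β :=
  hubbardScaleReportAt_subset_CT U μ h (D.scale : ℝ) D.nodal L β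

/-- **v1 certificates transfer**: a certified enclosure of the bare-frame report is one of the CT report
(`IsCertifiedEnclosure.mono_report`). [folklore] -/
theorem isCertifiedEnclosure_reportCT_of_report {U μ h : ℝ} {D : HubbardScaleData} {L₀ : ℕ}
    (hD : D.IsCertifiedEnclosure (hubbardScaleReport U μ D h) L₀) :
    D.IsCertifiedEnclosure (hubbardScaleReportCT U μ D h) L₀ :=
  hD.mono_report fun L β => hubbardScaleReport_subset_CT U μ D h L β

end TheReportCT

end Literature.MathematicalPhysics.QuantumLattice
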